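import Summits.HodgeConjecture.HodgeConjecture.Theorems.F0P3SpectralSideOfRecord                   -- ★ `trGp₀`, `trGp₀_def`, `clsBasis`, `Cls`, `rep`
import Summits.HodgeConjecture.HodgeConjecture.Theorems.F0P3SemilocalTestFunctionsOfRecord          -- ★ `TestS₀`, `tens₀`, `tens₀_smooth`
import Summits.HodgeConjecture.HodgeConjecture.Theorems.F0P3AnisotropicSmoothTraceExpansionHolds   -- ★ `anisotropicSmoothTraceExpansion_holds` (SSG, hypothesis-free via DM∞ B7)
import HarnessLib

/-!
# Crux `H413`, road «TF» brick B-TF1 — THE CLASS TRACE OF RECORD AT A TEST TENSOR IS BASIS- AND REPRESENTATIVE-FREE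
# `trGp₀ c (tens₀ S fS fT) = Σ_k ⟪b_k, R(f′_{S,∞} ⊗ f^S) b_k⟫` for EVERY discrete `P` in the class `c` and EVERY Hilbert basis `b` of `P`

F0∕P3 «U3-mult», cell `hodgecm-mathlib`, crux H413 (`stmt-HodgeConjecture-24833`); road «TF» (#84 `stub_TF` ∕ residual (A) `stub_trace_pureTensor` of
`Cruxes/H413/Lines/F0_P3_TraceFactorisationPaydown.lean`), brick list v1 (F0P3a-p07 (g5), 2026-08-31T21:51Z), owner F0P3a-p07 (g5); census
`F0/P3a/F0P3a-p07/g5/CENSUS-TF-arch.F0P3a-p07g5.md`.  THEOREMS ONLY over accepted tree modules: no definition, no named fact, no instance, no notation, no `sorry`;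
`--supports stmt-HodgeConjecture-24833 --as helper`.

WHAT.  The left-hand side of (A) is ★ `trGp₀ 𝒢 μ ν c F = Σ' k ⟪e^c_k, R(F) e^c_k⟫` read along the CHOSEN Hilbert basis ★ `clsBasis c` of the CHOSEN representative `rep c`
(★ `F0P3SpectralSideOfRecord` §1).  Since tonight the letter «SSG» ★ `UnitaryGroup.AnisotropicSmoothTraceExpansion L N H μ ν hanis` is a THEOREM of the tree with no
hypothesis beyond its binders (★ `anisotropicSmoothTraceExpansion_holds` = ★ S1 ∘ road «DM∞» B7 ★ p835258), and its clause (1) says: for every SMOOTH pure tensor `F`,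
unitarily equivalent discrete `P ≃ P′` and Hilbert bases `b`, `b′` of `P`, `P′`, the diagonal series of `R(F)` along `b` converges and equals the one along `b′`.  The test
tensors `tens₀ S fS fT = f′_{S,∞} ⊗ f^S` ARE smooth (★ `tens₀_smooth`).  Hence (this file):
* `summable_inner_integratedOperator_tens₀` — the diagonal series of `R(tens₀ S fS fT)` along any Hilbert basis of any discrete `P` converges;
* **`tsum_inner_integratedOperator_tens₀_eq_trGp₀`** — for every discrete `P` unitarily equivalent to `rep c` and every Hilbert basis `b` of `P.space`,
  `Σ' k ⟪b_k, R(tens₀ S fS fT) b_k⟫ = trGp₀ c (tens₀ S fS fT)`;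
* `trGp₀_tens₀_eq_tsum_of_hilbertBasis` — in particular `trGp₀ c (tens₀ S fS fT)` does not depend on the chosen basis of `rep c`;
* `summable_inner_integratedOperator_tens₀_clsBasis` — and the defining series of `trGp₀ c (tens₀ S fS fT)` converges (no junk `0`).
So the «chosen representative ∕ chosen basis» plumbing of (A)'s left-hand side is gone: any floor-1 proof of (A) may compute `tr π′(f′_{S,∞} ⊗ f^S)` on whichever
realisation and basis it likes.  Count-neutral (floor-1 preparation; (A) stays residual print on admissibility ∕ the arch–fin Hilbert split ∕ Harish-Chandra's Thm 8, census §2).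
HC_CM is proved only modulo the printed citations until rung 0 closes.

References: [Rogawski1990] §14.5 p. 237 («`T_{G′}(f′) = Σ m(π′) tr π′(f′)`», «`tr π′(f′)`»); [Gelbart1975] (9.11), (10.14); [ReedSimon1972] Thm. VI.24; [DixmierMalliavin1978] Thm. 3.1.
-/

set_option autoImplicit false
-- the mandated namespace repeats `HodgeConjecture.HodgeConjecture`, as in every `Theorems/*.lean` of this sub-problem
set_option linter.dupNamespace false

noncomputable section

open MeasureTheory Measure NumberField CompactlySupported IsDedekindDomain
open ContRepresentation
open Literature.NumberTheory.Automorphic Literature.NumberTheory.Automorphic.UnitaryGroup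
open scoped InnerProductSpace Matrix

namespace Summit.HodgeConjecture.HodgeConjecture.Cruxes.H413.F0P3ClassTraceConvSpan

open Summit.HodgeConjecture.HodgeConjecture.Cruxes.H413.F0P3ClassTokensOfRecord (Cls rep)
open Summit.HodgeConjecture.HodgeConjecture.Cruxes.H413.F0P3SpectralSideOfRecord (clsBasis trGp₀ trGp₀_def)
open Summit.HodgeConjecture.HodgeConjecture.Cruxes.H413.F0P3InnerFormClassificationV5 (Places)
open Summit.HodgeConjecture.HodgeConjecture.Cruxes.H413.F0P3SemilocalTestFunctionsOfRecord (TestS₀ tens₀ tens₀_smooth)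
open Summit.HodgeConjecture.HodgeConjecture.Cruxes.H413.F0P3TestFunctionsOfRecord (Unr₀)
open Summit.HodgeConjecture.HodgeConjecture.Cruxes.H413.F0P3AnisotropicSmoothTraceExpansionHolds (anisotropicSmoothTraceExpansion_holds)

variable (L : Type) [Field L] [NumberField L] [IsCMField L] (H : Matrix (Fin 3) (Fin 3) L) (ι : L →+* ℂ) (T : GL (Fin 3) ℂ)
  (hT : (T : Matrix (Fin 3) (Fin 3) ℂ)ᴴ * H.map ι * (T : Matrix (Fin 3) (Fin 3) ℂ) = Literature.Geometry.ComplexHyperbolic.BallModel.J)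
  [MeasurableSpace (cmDatum L 3 H).Adelic] [BorelSpace (cmDatum L 3 H).Adelic]
  (μ : Measure (cmDatum L 3 H).automorphicQuotient) [(cmDatum L 3 H).IsAutomorphicMeasure μ]
  (ν : Measure (cmDatum L 3 H).Adelic) [ν.IsHaarMeasure]
  (hanis : ∀ x : Fin 3 → L, Literature.AlgebraicGeometry.ShimuraVarieties.hermForm (cmConjRingHom L) H x x = 0 → x = 0)

include hanis

/-- **The diagonal series of `R(f′_{S,∞} ⊗ f^S)` on a discrete `P` CONVERGES** along every Hilbert basis of `P.space` (clause (1) of ★ SSG at the smooth tensor ★ `tens₀_smooth`).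
[cite: Rogawski1990, §14.5 p. 237] [cite: ReedSimon1972, Thm. VI.24] -/
theorem summable_inner_integratedOperator_tens₀ (S : Finset (Places L)) (fS : TestS₀ L H ι T hT S) (fT : Unr₀ L H S)
    (P : DiscreteAutomorphicRep (cmDatum L 3 H) μ) {κ : Type} (b : HilbertBasis κ ℂ P.space.toSubmodule) :
    Summable fun k => ⟪((b k : P.space.toSubmodule) : (cmDatum L 3 H).L2 μ),
        ((cmDatum L 3 H).rightRegular μ).integratedOperator ((cmDatum L 3 H).isUnitary_rightRegular μ)
          ((cmDatum L 3 H).isStronglyContinuous_rightRegular_holds μ) ν (tens₀ S fS fT) ((b k : P.space.toSubmodule) : (cmDatum L 3 H).L2 μ)⟫_ℂ :=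
  ((anisotropicSmoothTraceExpansion_holds L 3 H μ ν hanis (tens₀ S fS fT) (tens₀_smooth S fS fT)).2.1 P P
    (AreUnitarilyEquivalent.refl _) b b).1

/-- **THE CLASS TRACE OF RECORD AT A TEST TENSOR IS BASIS- AND REPRESENTATIVE-FREE**: for every `S`, `fS : TestS₀ S`, `fT : Unr₀ S`, every class `c`, every discrete `P`
unitarily equivalent to the representative `rep c` and every Hilbert basis `b` of `P.space`,
`Σ' k ⟪b_k, R(f′_{S,∞} ⊗ f^S) b_k⟫ = trGp₀ c (tens₀ S fS fT)` (clause (1) of ★ SSG with `P′ := rep c`, `b′ := clsBasis c`).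
[cite: Rogawski1990, §14.5 p. 237] [cite: Gelbart1975, (10.14)] [cite: DixmierMalliavin1978, Thm. 3.1] -/
theorem tsum_inner_integratedOperator_tens₀_eq_trGp₀ (S : Finset (Places L)) (fS : TestS₀ L H ι T hT S) (fT : Unr₀ L H S) (c : Cls (cmDatum L 3 H) μ)
    (P : DiscreteAutomorphicRep (cmDatum L 3 H) μ) (hP : AreUnitarilyEquivalent P.space.toContRep (rep (cmDatum L 3 H) μ c).space.toContRep)
    {κ : Type} (b : HilbertBasis κ ℂ P.space.toSubmodule) :
    ∑' k, ⟪((b k : P.space.toSubmodule) : (cmDatum L 3 H).L2 μ),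
        ((cmDatum L 3 H).rightRegular μ).integratedOperator ((cmDatum L 3 H).isUnitary_rightRegular μ)
          ((cmDatum L 3 H).isStronglyContinuous_rightRegular_holds μ) ν (tens₀ S fS fT) ((b k : P.space.toSubmodule) : (cmDatum L 3 H).L2 μ)⟫_ℂ =
      trGp₀ (cmDatum L 3 H) μ ν c (tens₀ S fS fT) := by
  rw [trGp₀_def]
  exact ((anisotropicSmoothTraceExpansion_holds L 3 H μ ν hanis (tens₀ S fS fT) (tens₀_smooth S fS fT)).2.1 P (rep (cmDatum L 3 H) μ c) hP b
    (clsBasis (cmDatum L 3 H) μ c)).2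

/-- **Corollary — basis-freeness on the representative**: `trGp₀ c (tens₀ S fS fT)` read along ANY Hilbert basis of `(rep c).space` is the same number.
[cite: Rogawski1990, §14.5 p. 237] [cite: ReedSimon1972, Thm. VI.24] -/
theorem trGp₀_tens₀_eq_tsum_of_hilbertBasis (S : Finset (Places L)) (fS : TestS₀ L H ι T hT S) (fT : Unr₀ L H S) (c : Cls (cmDatum L 3 H) μ)
    {κ : Type} (b : HilbertBasis κ ℂ (rep (cmDatum L 3 H) μ c).space.toSubmodule) :
    trGp₀ (cmDatum L 3 H) μ ν c (tens₀ S fS fT) =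
      ∑' k, ⟪((b k : (rep (cmDatum L 3 H) μ c).space.toSubmodule) : (cmDatum L 3 H).L2 μ),
        ((cmDatum L 3 H).rightRegular μ).integratedOperator ((cmDatum L 3 H).isUnitary_rightRegular μ)
          ((cmDatum L 3 H).isStronglyContinuous_rightRegular_holds μ) ν (tens₀ S fS fT)
            ((b k : (rep (cmDatum L 3 H) μ c).space.toSubmodule) : (cmDatum L 3 H).L2 μ)⟫_ℂ :=
  (tsum_inner_integratedOperator_tens₀_eq_trGp₀ L H ι T hT μ ν hanis S fS fT c (rep (cmDatum L 3 H) μ c) (AreUnitarilyEquivalent.refl _) b).symm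

/-- **The defining series of `trGp₀ c (tens₀ S fS fT)` converges** (along the chosen basis ★ `clsBasis c`): the class trace at a test tensor is a genuine sum, not a junk value.
[cite: Rogawski1990, §14.5 p. 237] [cite: ReedSimon1972, Thm. VI.24] -/
theorem summable_inner_integratedOperator_tens₀_clsBasis (S : Finset (Places L)) (fS : TestS₀ L H ι T hT S) (fT : Unr₀ L H S) (c : Cls (cmDatum L 3 H) μ) :
    Summable fun k => ⟪((clsBasis (cmDatum L 3 H) μ c k : (rep (cmDatum L 3 H) μ c).space.toSubmodule) : (cmDatum L 3 H).L2 μ),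
        ((cmDatum L 3 H).rightRegular μ).integratedOperator ((cmDatum L 3 H).isUnitary_rightRegular μ)
          ((cmDatum L 3 H).isStronglyContinuous_rightRegular_holds μ) ν (tens₀ S fS fT)
            ((clsBasis (cmDatum L 3 H) μ c k : (rep (cmDatum L 3 H) μ c).space.toSubmodule) : (cmDatum L 3 H).L2 μ)⟫_ℂ :=
  summable_inner_integratedOperator_tens₀ L H ι T hT μ ν hanis S fS fT (rep (cmDatum L 3 H) μ c) (clsBasis (cmDatum L 3 H) μ c)

/-- **HasSum form**: the defining series of the class trace at a test tensor sums to `trGp₀ c (tens₀ S fS fT)`. [cite: Rogawski1990, §14.5 p. 237] -/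
theorem hasSum_inner_integratedOperator_tens₀_trGp₀ (S : Finset (Places L)) (fS : TestS₀ L H ι T hT S) (fT : Unr₀ L H S) (c : Cls (cmDatum L 3 H) μ)
    (P : DiscreteAutomorphicRep (cmDatum L 3 H) μ) (hP : AreUnitarilyEquivalent P.space.toContRep (rep (cmDatum L 3 H) μ c).space.toContRep)
    {κ : Type} (b : HilbertBasis κ ℂ P.space.toSubmodule) :
    HasSum (fun k => ⟪((b k : P.space.toSubmodule) : (cmDatum L 3 H).L2 μ),
        ((cmDatum L 3 H).rightRegular μ).integratedOperator ((cmDatum L 3 H).isUnitary_rightRegular μ)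
          ((cmDatum L 3 H).isStronglyContinuous_rightRegular_holds μ) ν (tens₀ S fS fT) ((b k : P.space.toSubmodule) : (cmDatum L 3 H).L2 μ)⟫_ℂ)
      (trGp₀ (cmDatum L 3 H) μ ν c (tens₀ S fS fT)) := by
  rw [← tsum_inner_integratedOperator_tens₀_eq_trGp₀ L H ι T hT μ ν hanis S fS fT c P hP b]
  exact (summable_inner_integratedOperator_tens₀ L H ι T hT μ ν hanis S fS fT P b).hasSum

end Summit.HodgeConjecture.HodgeConjecture.Cruxes.H413.F0P3ClassTraceConvSpan

end
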